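import Literature.AlgebraicGeometry.Modules.UnitCocyclePresented
import HarnessLib

/-!
# A Čech class trivialised on the members of a saturated open cover is presented along the projection

Layer `Literature/AlgebraicGeometry/Modules`, namespace `Literature.AlgebraicGeometry.Modules`.
Pure Čech bookkeeping on one scheme `X`, then one use of «Stein» for a morphism `π : X ⟶ T` (`π^♯` bijective on
every open of `T`, as for `pr_T : P ×_K T → T` with `P` proper geometrically integral over a field,
`Motives/PushforwardStructureSheaf`):

* `UnitCocycle.TrivOn γ R` — an `X`-level TRIVIALISATION of the cocycle `γ` over the open `R ⊆ X`: units `λ_z` on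
  neighbourhoods `W_z ⊆ R ⊓ U_z` of the points `z ∈ R` with `λ_{z′} = λ_z · γ_{zz′}` (a `0`-cochain bounding `γ|_R`;
  data);
* `TrivOn.glueUnit` — two trivialisations over `R`, `R′` glue to a section `u ∈ Γ(X, R ⊓ R′)` with
  `u|_{W_z ⊓ W′_z} = λ_z · λ′_z⁻¹` (sheaf property of `𝒪_X`); `glueUnit_mul` (`u_{RR′} · u_{R′R″} = u_{RR″}`),
  `glueUnit_self` (`u_{RR} = 1`) by locality;
* `CechPic.mk_eq_mk_presented_of_trivOn` — if `γ` is trivialised over every member `π ⁻¹ᵁ U_a` of the preimage of an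
  open cover of `T` and `π^♯` is bijective on all opens, then `mk γ` is PRESENTED ALONG `π`
  (`Modules/UnitCocyclePresented`) by the base datum `G_ab := (π^♯)⁻¹ u_ab`.

With `CechPic.mk_presented_eq_one_of_section` (`Modules/CechPicDescentAlongSection`) this is the `Ȟ¹(–, 𝒪^×)` form,
over an ARBITRARY base, of [GortzWedhorn2023, Lemma 24.67]: a line bundle on `X` trivial on the members of a `π`-saturated
cover comes from `T`.  Everything is proved; no named facts (one data `structure`, three definitions with bodies).

## References
* [Hartshorne1977] R. Hartshorne, *Algebraic Geometry*, GTM 52 (1977), III §4 and Ex. III.4.4–4.5.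
* [GortzWedhorn2023] U. Görtz, T. Wedhorn, *Algebraic Geometry II: Cohomology of Schemes* (2023), Lemma 24.67 (p. 406).
* [StacksProject] The Stacks Project, Tag 09UY (Cohomology, §20.15 «Refinements and Čech cohomology»).
-/

noncomputable section

-- `TopCat.Presheaf` / `Scheme.Modules` are not reducible (as in Mathlib's `AlgebraicGeometry/Modules/Sheaf.lean`).
set_option backward.isDefEq.respectTransparency false

open CategoryTheory AlgebraicGeometry Opposite TopologicalSpace

namespace Literature.AlgebraicGeometry.Modules

universe u v

variable {X : Scheme.{u}}

namespace UnitCocycle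

variable (γ : UnitCocycle X)

/-- **An `X`-level trivialisation of the cocycle `γ` over the open `R`**: for every point `z ∈ R` an open
`W_z ∋ z` inside `R ⊓ U_z`, a unit `λ_z` over every open below `W_z` (with a chosen inverse), compatible with
restriction, such that `λ_{z′} = λ_z · γ_{zz′}` — a `0`-cochain whose Čech coboundary is `γ|_R`.
[cite: Hartshorne1977, III §4 and Ex. III.4.4] -/
structure TrivOn (R : X.Opens) where
  /-- the neighbourhood `W_z` of `z ∈ R` -/
  W : R → X.Opens
  /-- `z ∈ W_z` -/
  mem : ∀ z : R, (z : X) ∈ W z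
  /-- `W_z ⊆ R` -/
  le : ∀ z : R, W z ≤ R
  /-- `W_z ⊆ U_z` -/
  leU : ∀ z : R, W z ≤ γ.U z
  /-- the unit `λ_z` over `V ≤ W_z` -/
  lam : ∀ (z : R) (V : X.Opens), V ≤ W z → Γ(X, V)
  /-- a chosen inverse of `λ_z` -/
  inv : ∀ (z : R) (V : X.Opens), V ≤ W z → Γ(X, V)
  /-- compatibility with restriction -/
  map_lam : ∀ (z : R) {V V' : X.Opens} (h : V ≤ W z) (i : V' ≤ V), secRes X i (lam z V h) = lam z V' (i.trans h)
  /-- `λ_z λ_z⁻¹ = 1` -/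
  lam_mul_inv : ∀ (z : R) (V : X.Opens) (h : V ≤ W z), lam z V h * inv z V h = 1
  /-- the coboundary relation `λ_{z′} = λ_z γ_{zz′}` -/
  rel : ∀ (z z' : R) (V : X.Opens) (hz : V ≤ W z) (hz' : V ≤ W z'),
    lam z' V hz' = lam z V hz * γ.g z z' V (hz.trans (leU z)) (hz'.trans (leU z'))

namespace TrivOn

variable {γ} {R R' R'' : X.Opens} (t : γ.TrivOn R) (t' : γ.TrivOn R') (t'' : γ.TrivOn R'')

/-- The chosen inverses are compatible with restriction (uniqueness of inverses). [cite: Hartshorne1977, III §4 and Ex. III.4.4] -/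
theorem map_inv (z : R) {V V' : X.Opens} (h : V ≤ t.W z) (i : V' ≤ V) :
    secRes X i (t.inv z V h) = t.inv z V' (i.trans h) := by
  have h₁ : t.lam z V' (i.trans h) * secRes X i (t.inv z V h) = 1 := by
    rw [← t.map_lam z h i, ← map_mul, t.lam_mul_inv, map_one]
  have h₂ := t.lam_mul_inv z V' (i.trans h)
  calc secRes X i (t.inv z V h)
      = secRes X i (t.inv z V h) * (t.lam z V' (i.trans h) * t.inv z V' (i.trans h)) := by rw [h₂, mul_one]
    _ = t.lam z V' (i.trans h) * secRes X i (t.inv z V h) * t.inv z V' (i.trans h) := by ring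
    _ = t.inv z V' (i.trans h) := by rw [h₁, one_mul]

/-- `λ_z⁻¹ λ_z = 1`. [cite: Hartshorne1977, III §4 and Ex. III.4.4] -/
theorem inv_mul_lam (z : R) (V : X.Opens) (h : V ≤ t.W z) : t.inv z V h * t.lam z V h = 1 := by
  rw [mul_comm, t.lam_mul_inv]

/-- The inverses satisfy the inverse relation: `λ_{z′}⁻¹ = λ_z⁻¹ γ_{z′z}`. [cite: Hartshorne1977, III §4 and Ex. III.4.4] -/
theorem rel_inv (z z' : R) (V : X.Opens) (hz : V ≤ t.W z) (hz' : V ≤ t.W z') :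
    t.inv z' V hz' = t.inv z V hz * γ.g z' z V (hz'.trans (t.leU z')) (hz.trans (t.leU z)) := by
  have h := t.rel z z' V hz hz'
  have hu := t.lam_mul_inv z' V hz'
  have hu' := t.lam_mul_inv z V hz
  have hγ := γ.g_mul_symm z z' V (hz.trans (t.leU z)) (hz'.trans (t.leU z'))
  -- `inv z' = inv z' · (lam z · inv z) · (g zz' · g z'z) = (inv z' · lam z') · inv z · g z'z`
  calc t.inv z' V hz'
      = t.inv z' V hz' * (t.lam z V hz * t.inv z V hz) *
          (γ.g z z' V (hz.trans (t.leU z)) (hz'.trans (t.leU z')) * γ.g z' z V (hz'.trans (t.leU z')) (hz.trans (t.leU z))) := by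
        rw [hu', hγ, mul_one, mul_one]
    _ = (t.lam z V hz * γ.g z z' V (hz.trans (t.leU z)) (hz'.trans (t.leU z')) * t.inv z' V hz') *
          (t.inv z V hz * γ.g z' z V (hz'.trans (t.leU z')) (hz.trans (t.leU z))) := by ring
    _ = t.inv z V hz * γ.g z' z V (hz'.trans (t.leU z')) (hz.trans (t.leU z)) := by rw [← h, hu, one_mul]

/-! ### Gluing two trivialisations into a unit on `R ⊓ R′` -/

/-- the piece of the cover of `R ⊓ R′` at the point `z`: `W_z ⊓ W′_z` (reducible). [folklore] -/
abbrev piece (z : ↥(R ⊓ R')) : X.Opens :=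
  t.W ⟨z, z.2.1⟩ ⊓ t'.W ⟨z, z.2.2⟩

/-- The pieces lie in `R ⊓ R′`. [cite: Hartshorne1977, III §4 and Ex. III.4.4] -/
theorem piece_le (z : ↥(R ⊓ R')) : piece t t' z ≤ R ⊓ R' :=
  le_inf (inf_le_left.trans (t.le _)) (inf_le_right.trans (t'.le _))

/-- The pieces cover `R ⊓ R′`. [cite: Hartshorne1977, III §4 and Ex. III.4.4] -/
theorem le_iSup_piece : R ⊓ R' ≤ iSup (piece t t') :=
  fun x hx => Opens.mem_iSup.2 ⟨⟨x, hx⟩, ⟨t.mem ⟨x, hx.1⟩, t'.mem ⟨x, hx.2⟩⟩⟩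

/-- the local section `λ_z · λ′_z⁻¹` on the piece at `z`. [folklore] -/
def localUnit (z : ↥(R ⊓ R')) : Γ(X, piece t t' z) :=
  t.lam ⟨z, z.2.1⟩ (piece t t' z) inf_le_left * t'.inv ⟨z, z.2.2⟩ (piece t t' z) inf_le_right

/-- The local sections restricted to an open below two pieces agree (`λ_w λ′_w⁻¹ = λ_z γ_{zw} λ′_z⁻¹ γ_{wz} = λ_z λ′_z⁻¹`).
[cite: Hartshorne1977, III §4] -/
theorem secRes_localUnit_eq (z w : ↥(R ⊓ R')) (V : X.Opens) (hz : V ≤ piece t t' z) (hw : V ≤ piece t t' w) :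
    secRes X hz (localUnit t t' z) = secRes X hw (localUnit t t' w) := by
  unfold localUnit
  rw [map_mul, map_mul, t.map_lam, t'.map_inv, t.map_lam, t'.map_inv,
    t.rel ⟨z, z.2.1⟩ ⟨w, w.2.1⟩ V (hz.trans inf_le_left) (hw.trans inf_le_left),
    t'.rel_inv ⟨z, z.2.2⟩ ⟨w, w.2.2⟩ V (hz.trans inf_le_right) (hw.trans inf_le_right)]
  have hγ := γ.g_mul_symm (z : X) (w : X) V ((hz.trans inf_le_left).trans (t.leU _))
    ((hw.trans inf_le_left).trans (t.leU _))
  -- `(λ_z g_zw)(λ'_z⁻¹ g_wz) = λ_z λ'_z⁻¹ (g_zw g_wz)`; the `g`'s only depend on the points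
  have e₁ : γ.g (w : X) (z : X) V ((hw.trans inf_le_right).trans (t'.leU _)) ((hz.trans inf_le_right).trans (t'.leU _)) =
      γ.g (w : X) (z : X) V ((hw.trans inf_le_left).trans (t.leU _)) ((hz.trans inf_le_left).trans (t.leU _)) := rfl
  rw [e₁]
  symm
  calc t.lam ⟨z, z.2.1⟩ V _ * γ.g (z : X) (w : X) V _ _ * (t'.inv ⟨z, z.2.2⟩ V _ * γ.g (w : X) (z : X) V _ _)
      = t.lam ⟨z, z.2.1⟩ V (hz.trans inf_le_left) * t'.inv ⟨z, z.2.2⟩ V (hz.trans inf_le_right) *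
          (γ.g (z : X) (w : X) V ((hz.trans inf_le_left).trans (t.leU _)) ((hw.trans inf_le_left).trans (t.leU _)) *
            γ.g (w : X) (z : X) V ((hw.trans inf_le_left).trans (t.leU _)) ((hz.trans inf_le_left).trans (t.leU _))) := by
        ring
    _ = t.lam ⟨z, z.2.1⟩ V (hz.trans inf_le_left) * t'.inv ⟨z, z.2.2⟩ V (hz.trans inf_le_right) := by rw [hγ, mul_one]

/-- The local sections form a compatible family. [cite: Hartshorne1977, III §4 and Ex. III.4.4] -/
theorem isCompatible_localUnit : TopCat.Presheaf.IsCompatible X.presheaf (piece t t') (localUnit t t') :=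
  fun z w => secRes_localUnit_eq t t' z w _ inf_le_left inf_le_right

/-- **The glued unit** `u ∈ Γ(X, R ⊓ R′)` with `u|_{W_z ⊓ W′_z} = λ_z λ′_z⁻¹`. [cite: Hartshorne1977, III §4 and Ex. III.4.4] -/
def glueUnit : Γ(X, R ⊓ R') :=
  (X.sheaf.existsUnique_gluing' (piece t t') (R ⊓ R') (fun z => homOfLE (piece_le t t' z)) (le_iSup_piece t t')
    (localUnit t t') (isCompatible_localUnit t t')).choose

/-- The glued unit restricts to the local sections. [cite: Hartshorne1977, III §4 and Ex. III.4.4] -/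
theorem secRes_glueUnit (z : ↥(R ⊓ R')) : secRes X (piece_le t t' z) (glueUnit t t') = localUnit t t' z :=
  (X.sheaf.existsUnique_gluing' (piece t t') (R ⊓ R') (fun z => homOfLE (piece_le t t' z)) (le_iSup_piece t t')
    (localUnit t t') (isCompatible_localUnit t t')).choose_spec.1 z

/-- The glued unit restricted to any open below a piece. [cite: Hartshorne1977, III §4 and Ex. III.4.4] -/
theorem secRes_glueUnit_of_le (z : ↥(R ⊓ R')) (V : X.Opens) (hV : V ≤ piece t t' z) :
    secRes X (hV.trans (piece_le t t' z)) (glueUnit t t') =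
      t.lam ⟨z, z.2.1⟩ V (hV.trans inf_le_left) * t'.inv ⟨z, z.2.2⟩ V (hV.trans inf_le_right) := by
  rw [← secRes_secRes (piece_le t t' z) hV, secRes_glueUnit]
  unfold localUnit
  rw [map_mul, t.map_lam, t'.map_inv]

/-- **Local description at two points**: on `V ≤ W_z ⊓ W′_{z′}`, `u|_V = λ_z · γ_{zz′} · λ′_{z′}⁻¹`. [cite: Hartshorne1977, III §4 and Ex. III.4.4] -/
theorem secRes_glueUnit_of_le₂ (z : R) (z' : R') (V : X.Opens) (hz : V ≤ t.W z) (hz' : V ≤ t'.W z')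
    (hV : V ≤ R ⊓ R') :
    secRes X hV (glueUnit t t') =
      t.lam z V hz * γ.g z z' V (hz.trans (t.leU z)) (hz'.trans (t'.leU z')) * t'.inv z' V hz' := by
  -- compare locally around each point of `V`
  apply X.sheaf.eq_of_locally_eq' (fun x : V => V ⊓ piece t t' ⟨x, hV x.2⟩) V (fun x => homOfLE inf_le_left)
  · intro x hx
    exact Opens.mem_iSup.2 ⟨⟨x, hx⟩, ⟨hx, t.mem _, t'.mem _⟩⟩
  · intro x
    have hxV : V ⊓ piece t t' ⟨x, hV x.2⟩ ≤ V := inf_le_left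
    change secRes X hxV (secRes X hV (glueUnit t t')) = secRes X hxV _
    rw [secRes_secRes, map_mul, map_mul, t.map_lam, t'.map_inv, γ.map_g]
    have key := secRes_glueUnit_of_le t t' ⟨x, hV x.2⟩ (V ⊓ piece t t' ⟨x, hV x.2⟩) inf_le_right
    rw [show secRes X (hxV.trans hV) (glueUnit t t') =
        secRes X ((inf_le_right : V ⊓ piece t t' ⟨x, hV x.2⟩ ≤ _).trans (piece_le t t' _)) (glueUnit t t') from rfl, key]
    -- `λ_x λ'_x⁻¹ = λ_z g_{zx} (λ'_{z'} g_{z'x})⁻¹ = λ_z g_{z z'} λ'_{z'}⁻¹`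
    rw [t.rel z ⟨x, (hV x.2).1⟩ _ (hxV.trans hz) (inf_le_right.trans inf_le_left),
      t'.rel_inv z' ⟨x, (hV x.2).2⟩ _ (hxV.trans hz') (inf_le_right.trans inf_le_right)]
    have hγ := γ.g_mul (z : X) (x : X) (z' : X) (V ⊓ piece t t' ⟨x, hV x.2⟩)
      ((hxV.trans hz).trans (t.leU z)) ((inf_le_right.trans inf_le_left).trans (t.leU _))
      ((hxV.trans hz').trans (t'.leU z'))
    have e₁ : γ.g (x : X) (z' : X) (V ⊓ piece t t' ⟨x, hV x.2⟩) ((inf_le_right.trans inf_le_right).trans (t'.leU _))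
        ((hxV.trans hz').trans (t'.leU z')) =
      γ.g (x : X) (z' : X) (V ⊓ piece t t' ⟨x, hV x.2⟩) ((inf_le_right.trans inf_le_left).trans (t.leU _))
        ((hxV.trans hz').trans (t'.leU z')) := rfl
    rw [e₁, ← hγ]
    ring

/-! ### The cocycle identities of the glued units -/

/-- **`u_{RR′} · u_{R′R″} = u_{RR″}`** on `R ⊓ R′ ⊓ R″`. [cite: Hartshorne1977, III §4] -/
theorem glueUnit_mul (i₁ : R ⊓ R' ⊓ R'' ≤ R ⊓ R') (i₂ : R ⊓ R' ⊓ R'' ≤ R' ⊓ R'') (i₃ : R ⊓ R' ⊓ R'' ≤ R ⊓ R'') :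
    secRes X i₁ (glueUnit t t') * secRes X i₂ (glueUnit t' t'') = secRes X i₃ (glueUnit t t'') := by
  apply X.sheaf.eq_of_locally_eq'
    (fun x : ↥(R ⊓ R' ⊓ R'') => t.W ⟨x, x.2.1.1⟩ ⊓ t'.W ⟨x, x.2.1.2⟩ ⊓ t''.W ⟨x, x.2.2⟩) (R ⊓ R' ⊓ R'')
    (fun x => homOfLE (le_inf (le_inf ((inf_le_left.trans inf_le_left).trans (t.le _))
      ((inf_le_left.trans inf_le_right).trans (t'.le _))) (inf_le_right.trans (t''.le _))))
  · intro x hx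
    exact Opens.mem_iSup.2 ⟨⟨x, hx⟩, ⟨⟨t.mem _, t'.mem _⟩, t''.mem _⟩⟩
  · intro x
    set V := t.W ⟨x, x.2.1.1⟩ ⊓ t'.W ⟨x, x.2.1.2⟩ ⊓ t''.W ⟨x, x.2.2⟩ with hVdef
    have hV : V ≤ R ⊓ R' ⊓ R'' := le_inf (le_inf ((inf_le_left.trans inf_le_left).trans (t.le _))
      ((inf_le_left.trans inf_le_right).trans (t'.le _))) (inf_le_right.trans (t''.le _))
    change secRes X hV _ = secRes X hV _
    rw [map_mul, secRes_secRes, secRes_secRes, secRes_secRes,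
      secRes_glueUnit_of_le₂ t t' ⟨x, x.2.1.1⟩ ⟨x, x.2.1.2⟩ V (inf_le_left.trans inf_le_left)
        (inf_le_left.trans inf_le_right) (hV.trans i₁),
      secRes_glueUnit_of_le₂ t' t'' ⟨x, x.2.1.2⟩ ⟨x, x.2.2⟩ V (inf_le_left.trans inf_le_right) inf_le_right
        (hV.trans i₂),
      secRes_glueUnit_of_le₂ t t'' ⟨x, x.2.1.1⟩ ⟨x, x.2.2⟩ V (inf_le_left.trans inf_le_left) inf_le_right (hV.trans i₃)]
    simp only [γ.g_self, mul_one]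
    have h := t'.inv_mul_lam ⟨x, x.2.1.2⟩ V (inf_le_left.trans inf_le_right)
    calc t.lam _ V _ * t'.inv _ V _ * (t'.lam _ V _ * t''.inv _ V _)
        = t.lam _ V _ * (t'.inv _ V _ * t'.lam _ V _) * t''.inv _ V _ := by ring
      _ = t.lam _ V _ * t''.inv _ V _ := by rw [h, mul_one]

/-- **`u_{RR} = 1`**. [cite: Hartshorne1977, III §4] -/
theorem glueUnit_self : glueUnit t t = 1 := by
  apply X.sheaf.eq_of_locally_eq' (fun x : ↥(R ⊓ R) => t.W ⟨x, x.2.1⟩) (R ⊓ R)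
    (fun x => homOfLE (le_inf (t.le _) (t.le _)))
  · intro x hx
    exact Opens.mem_iSup.2 ⟨⟨x, hx⟩, t.mem _⟩
  · intro x
    have hV : t.W ⟨x, x.2.1⟩ ≤ R ⊓ R := le_inf (t.le _) (t.le _)
    change secRes X hV _ = secRes X hV _
    rw [map_one, secRes_glueUnit_of_le₂ t t ⟨x, x.2.1⟩ ⟨x, x.2.2⟩ _ le_rfl le_rfl hV, γ.g_self, mul_one]
    exact t.lam_mul_inv _ _ _

end TrivOn

end UnitCocycle

/-! ### Presentation along a Stein morphism `π` -/

namespace CechPic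

variable {T : Scheme.{u}} (π : X ⟶ T) (hπ : ∀ U : T.Opens, Function.Bijective (π.app U))
  {S : Type v} (U : S → T.Opens) (idx : T → S) (mem : ∀ t, t ∈ U (idx t))
  (γ : UnitCocycle X)

include hπ in
/-- the base section under `u_{ab}`: `G_ab := (π.app _)⁻¹ u_ab`. [cite: Hartshorne1977, III §4 and Ex. III.4.4] -/
theorem exists_base_datum (t : ∀ a : S, γ.TrivOn (π ⁻¹ᵁ U a)) :
    ∃ G : ∀ a b : S, Γ(T, U a ⊓ U b), ∀ a b, π.app _ (G a b) = UnitCocycle.TrivOn.glueUnit (t a) (t b) :=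
  ⟨fun a b => (hπ (U a ⊓ U b)).2 (UnitCocycle.TrivOn.glueUnit (t a) (t b)) |>.choose,
    fun a b => (hπ (U a ⊓ U b)).2 (UnitCocycle.TrivOn.glueUnit (t a) (t b)) |>.choose_spec⟩

include hπ mem in
/-- **A class trivialised on every member of the preimage of an open cover of `T` is PRESENTED ALONG `π`**
(by the base datum `G_ab = (π^♯)⁻¹ u_ab` of glued units), for `π.app` bijective on every open.
[cite: GortzWedhorn2023, Lemma 24.67 (p. 406)] [cite: Hartshorne1977, III §4 and Ex. III.4.4] -/
theorem mk_eq_mk_presented_of_trivOn (t : ∀ a : S, γ.TrivOn (π ⁻¹ᵁ U a)) :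
    ∃ (G : ∀ a b : S, Γ(T, U a ⊓ U b))
      (_ : ∀ (a b c : S) (i₁ : U a ⊓ U b ⊓ U c ≤ U a ⊓ U b) (i₂ : U a ⊓ U b ⊓ U c ≤ U b ⊓ U c)
        (i₃ : U a ⊓ U b ⊓ U c ≤ U a ⊓ U c), secRes T i₁ (G a b) * secRes T i₂ (G b c) = secRes T i₃ (G a c))
      (_ : ∀ a : S, IsUnit (G a a))
      (gX : UnitCocycle X) (hUX : ∀ x, gX.U x = π ⁻¹ᵁ U (idx (π.base x)))
      (_ : ∀ (x x' : X) (V : X.Opens) (hx : V ≤ gX.U x) (hx' : V ≤ gX.U x'),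
        gX.g x x' V hx hx' = π.appLE (U (idx (π.base x)) ⊓ U (idx (π.base x'))) V
          (UnitCocycle.le_preimage_inf π (hx.trans_eq (hUX x)) (hx'.trans_eq (hUX x')))
          (G (idx (π.base x)) (idx (π.base x')))),
      CechPic.mk γ = CechPic.mk gX := by
  obtain ⟨G, hG⟩ := exists_base_datum π hπ U γ t
  -- the cocycle identity and the unit property of the base datum, by injectivity of `π^♯`
  have hmul : ∀ (a b c : S) (i₁ : U a ⊓ U b ⊓ U c ≤ U a ⊓ U b) (i₂ : U a ⊓ U b ⊓ U c ≤ U b ⊓ U c)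
      (i₃ : U a ⊓ U b ⊓ U c ≤ U a ⊓ U c), secRes T i₁ (G a b) * secRes T i₂ (G b c) = secRes T i₃ (G a c) := by
    intro a b c i₁ i₂ i₃
    apply (hπ _).1
    rw [map_mul, app_secRes, app_secRes, app_secRes, hG a b, hG b c, hG a c]
    exact UnitCocycle.TrivOn.glueUnit_mul (t a) (t b) (t c) _ _ _
  have hunit : ∀ a : S, IsUnit (G a a) := by
    intro a
    have h0 : π.app (U a ⊓ U a) (G a a) = π.app (U a ⊓ U a) 1 := by
      rw [hG a a, map_one]
      exact UnitCocycle.TrivOn.glueUnit_self (t a)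
    have h1 : G a a = 1 := (hπ (U a ⊓ U a)).1 h0
    rw [h1]; exact isUnit_one
  obtain ⟨gX, hUX, hgX⟩ := UnitCocycle.exists_presented π (fun x => idx (π.base x)) U G (fun x => mem (π.base x))
    (fun a b c i₁ i₂ i₃ => congrArg (π.app _) (hmul a b c i₁ i₂ i₃)) (fun a => (hunit a).map (π.app _).hom)
  refine ⟨G, hmul, hunit, gX, hUX, hgX, ?_⟩
  -- the coboundary `λ_x := λ^{idx (π x)}_x` from `γ` to `gX`
  refine CechPic.sound ⟨{
    W := fun x => (t (idx (π.base x))).W ⟨x, mem (π.base x)⟩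
    mem := fun x => (t (idx (π.base x))).mem ⟨x, mem (π.base x)⟩
    le := fun x => (t (idx (π.base x))).leU ⟨x, mem (π.base x)⟩
    le' := fun x => ((t (idx (π.base x))).le ⟨x, mem (π.base x)⟩).trans_eq (hUX x).symm
    lam := fun x V h => (t (idx (π.base x))).lam ⟨x, mem (π.base x)⟩ V h
    inv := fun x V h => (t (idx (π.base x))).inv ⟨x, mem (π.base x)⟩ V h
    map_lam := fun x V V' h i => (t (idx (π.base x))).map_lam ⟨x, mem (π.base x)⟩ h i
    lam_mul_inv := fun x V h => (t (idx (π.base x))).lam_mul_inv ⟨x, mem (π.base x)⟩ V h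
    rel := fun x x' V hx hx' => ?_ }⟩
  -- `gX_{xx'} λ_{x'} = λ_x γ_{xx'}` where `gX_{xx'} = π^♯ G_{ab}|_V = u_{ab}|_V = λ_x γ_{xx'} λ'_{x'}⁻¹`
  -- (`a := idx (π x)`, `b := idx (π x')`; the two spellings `π⁻¹(U_a ⊓ U_b)` / `π⁻¹U_a ⊓ π⁻¹U_b` are defeq)
  have hV : V ≤ π ⁻¹ᵁ (U (idx (π.base x)) ⊓ U (idx (π.base x'))) :=
    UnitCocycle.le_preimage_inf π (hx.trans ((t (idx (π.base x))).le ⟨x, mem (π.base x)⟩))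
      (hx'.trans ((t (idx (π.base x'))).le ⟨x', mem (π.base x')⟩))
  have hV' : V ≤ π ⁻¹ᵁ U (idx (π.base x)) ⊓ π ⁻¹ᵁ U (idx (π.base x')) :=
    le_inf (hx.trans ((t (idx (π.base x))).le ⟨x, mem (π.base x)⟩))
      (hx'.trans ((t (idx (π.base x'))).le ⟨x', mem (π.base x')⟩))
  -- `π^♯ G_{ab}` over `V` is the restriction of `π^♯ G_{ab}` over `π⁻¹(U_a ⊓ U_b)`
  have e0 : π.appLE (U (idx (π.base x)) ⊓ U (idx (π.base x'))) V hV (G (idx (π.base x)) (idx (π.base x'))) =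
      secRes X hV (π.app _ (G (idx (π.base x)) (idx (π.base x')))) := by
    rw [Scheme.Hom.app_eq_appLE, secRes_appLE]
  -- … which is the restriction of the glued unit
  have e1 : gX.g x x' V (hx.trans (((t (idx (π.base x))).le ⟨x, mem (π.base x)⟩).trans_eq (hUX x).symm))
      (hx'.trans (((t (idx (π.base x'))).le ⟨x', mem (π.base x')⟩).trans_eq (hUX x').symm)) =
      secRes X hV' (UnitCocycle.TrivOn.glueUnit (t (idx (π.base x))) (t (idx (π.base x')))) :=
    ((hgX x x' V _ _).trans e0).trans
      (congrArg (secRes X hV) (hG (idx (π.base x)) (idx (π.base x'))))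
  rw [e1, UnitCocycle.TrivOn.secRes_glueUnit_of_le₂ (t (idx (π.base x))) (t (idx (π.base x')))
    ⟨x, mem (π.base x)⟩ ⟨x', mem (π.base x')⟩ V hx hx' hV']
  have h := (t (idx (π.base x'))).inv_mul_lam ⟨x', mem (π.base x')⟩ V hx'
  calc (t (idx (π.base x))).lam _ V hx * γ.g x x' V _ _ * (t (idx (π.base x'))).inv _ V hx' *
        (t (idx (π.base x'))).lam _ V hx'
      = (t (idx (π.base x))).lam _ V hx * γ.g x x' V _ _ *
          ((t (idx (π.base x'))).inv _ V hx' * (t (idx (π.base x'))).lam _ V hx') := by ring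
    _ = (t (idx (π.base x))).lam _ V hx * γ.g x x' V _ _ := by rw [h, mul_one]

end CechPic

end Literature.AlgebraicGeometry.Modules

end
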